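import Literature.NumberTheory.LFunctions.MoebiusWalshCircuitsACdProofs
import Literature.NumberTheory.LFunctions.MoebiusWalshCircuitsFourierWalshProofs
import HarnessLib

/-!
# Green 2012, Theorem 1 for the Liouville function — the discharge of `green_liouville_ACd`

Topic `Literature/NumberTheory/LFunctions`, proofs-only sibling of `MoebiusWalshCircuits.lean`
(the named fact `Literature.NumberTheory.LFunctions.green_liouville_ACd`: B. Green, *On (not)
computing the Möbius function using bounded depth circuits*, Combin. Probab. Comput. **21** (2012)
942–951 [Green2012], Theorem 1 — an `AC⁰(d)` function `F : {0,…,2ⁿ-1} → {±1}` of depth `≤ d` and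
size `≤ n^d` has `𝔼_x λ(x)F(x) = O(e^{d log n - c n^{1/(6d)}})` — read for the Liouville function on
the strength of the printed §1 remark "All of the results in this paper hold equally well for the
Liouville function, with very similar proofs").

Both halves of Green's proof are PROVED in the tree: Proposition 1 for `λ` is
`green_liouville_fourierWalsh_holds` (`MoebiusWalshCircuitsFourierWalshProofs.lean`: Kátai's
Proposition 2, Proposition 3 for `λ` from the minor-arc Proposition 4, the Harman–Kátai Lemma 1 and
Corollary 2 of Theorem 3), and the §2 deduction Theorem 1 ⇐ Proposition 1 (Parseval, the trivial
bound on the low levels, Cauchy–Schwarz, the Linial–Mansour–Nisan/Tal Fourier tails) is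
`green_liouville_ACd_of_fourierWalsh` (`MoebiusWalshCircuitsACdProofs.lean`). This file only composes
them (`green_liouville_ACd_holds`); nothing else is here. This is the fact consumed by route
`PneNP/Mobius` (support `Mobius.LiouvilleNotAC0`) in the `LFunctions` rendering; the `Sieve`
rendering `Literature.NumberTheory.Sieve.green_liouville_AC0` is discharged separately
(`Sieve/GreenLiouvilleAC0Holds.lean`, through `green_liouville_AC0_of_fourierWalsh`).

## References

* B. Green, Combin. Probab. Comput. 21 (2012) 942–951, Theorem 1, §1 (remark on `λ`), §2
  (deduction from Proposition 1), §§3–4 (Proposition 1). [Green2012]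
-/

namespace Literature.NumberTheory.LFunctions

/-- **Green 2012, Theorem 1 for the Liouville function — PROVED**: there are absolute `c > 0`, `K`
such that for `d, n ≥ 1` and every circuit `C` over `acBasis` on the `n` binary digits with
`depth ≤ d`, `size ≤ n^d`, `|Σ_{x∈{0,1}ⁿ} λ(val x)(±1)^{C(x)}| / 2ⁿ ≤ K e^{d log n - c n^{1/(6d)}}` —
Green's §2 deduction (`green_liouville_ACd_of_fourierWalsh`) applied to the proved Proposition 1
for `λ` (`green_liouville_fourierWalsh_holds`). [cite: Green2012, Theorem 1 and §1 (remark on λ)] -/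
theorem green_liouville_ACd_holds : green_liouville_ACd :=
  green_liouville_ACd_of_fourierWalsh green_liouville_fourierWalsh_holds

end Literature.NumberTheory.LFunctions
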